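import Summits.NavierStokesRegularity.NavierStokesRegularity.Theorems.FrozenSignCascadeBoundedEnvelopeContinuationClayOfBackwardBounded
import HarnessLib

/-!
# Route PlaneEnergyCeiling · crux `BoundedPlanarEnergyRegularity` — stub `stub_localClayTheory`

Helper file for the crux item stmt-NavierStokesRegularity-16921
(`Theses.PlaneEnergyCeiling.BoundedPlanarEnergyRegularity`), registered stub
`stub_localClayTheory` of the lines `Lines/birth.lean` and `Lines/radon_topside.lean` (shared
verbatim by both lines); landed `--supports` that item.

**Statement (per-datum local Clay theory / per-datum `NoBlowupToClay`).** For `ν > 0` and a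
smooth, divergence-free, rapidly decaying datum `u₀`: if every classical solution `(u, p)` of the
unforced Navier–Stokes system on `ℝ³ × [0, T)` which is Leray–Hopf on `[0, T]` from `u 0 = u₀`
extends smoothly past `T` (every `T > 0`), then Clay (A) holds for `u₀` — a global smooth solution
with bounded energy.

Proof: a smooth extension past `T` makes `u` bounded on every small backward parabolic cylinder
below `(T, x₀)` (the extension is continuous on the compact set `[0, (T+T')/2] × B̄₁(x₀)` and
agrees with `u` before `T`), i.e. `IsBackwardBoundedAt u T x₀` at every `x₀`; then the per-datum
theorem `BoundedEnvelope.stub_clayOfBackwardBounded` (item 0055 for one datum: Kato's maximal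
time is infinite, von Wahl / Lemarié-Rieusset 2016 Prop. 12.3 gives the Clay solution) applies.

References: Kato 1984; Lemarié-Rieusset 2016 (Thm. 15.1, Prop. 12.3).
-/

noncomputable section

set_option linter.dupNamespace false -- nested layout Summit.<S>.<Sub>, Sub = S (D-0017)

open MeasureTheory TopologicalSpace Set Function Filter Metric
open _root_.Topology
open scoped ENNReal NNReal
open Literature.Analysis.FluidPDE

namespace Summit.NavierStokesRegularity.NavierStokesRegularity.Theorems.PlaneEnergyCeilingBoundedPlanarEnergyRegularity

/-- **A smooth extension past `T` gives backward boundedness at every `(T, x₀)`.** If the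
velocity `u` on `[0, T)`, `T > 0`, agrees on `[0, T)` with a classical solution on `[0, T')`,
`T' > T`, then `u` is bounded on the backward cylinder `(T - r², T) × B_r(x₀)` for
`r = min 1 (√T / 2)` (continuity of the extension on the compact `[0, (T+T')/2] × B̄₁(x₀)`).
[folklore] -/
theorem isBackwardBoundedAt_of_hasSmoothExtensionPast {ν T : ℝ} (hT : 0 < T)
    {u : ℝ → EuclideanSpace ℝ (Fin 3) → EuclideanSpace ℝ (Fin 3)}
    (hext : HasSmoothExtensionPast ν 0 u T) (x₀ : EuclideanSpace ℝ (Fin 3)) :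
    IsBackwardBoundedAt u T x₀ := by
  obtain ⟨T', hTT', W, Pr, hW, hWU⟩ := hext
  set T'' : ℝ := (T + T') / 2 with hT''_def
  have hTT'' : T < T'' := by rw [hT''_def]; linarith
  have hT''T' : T'' < T' := by rw [hT''_def]; linarith
  set K : Set (ℝ × EuclideanSpace ℝ (Fin 3)) := Icc 0 T'' ×ˢ closedBall x₀ 1 with hK_def
  have hK : IsCompact K := isCompact_Icc.prod (isCompact_closedBall x₀ 1)
  have hKsub : K ⊆ Ico 0 T' ×ˢ univ := prod_mono (Icc_subset_Ico_right hT''T') (subset_univ _)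
  obtain ⟨M, hM⟩ := hK.exists_bound_of_continuousOn (hW.smooth_velocity.continuousOn.mono hKsub)
  set r : ℝ := min 1 (Real.sqrt T / 2) with hr_def
  have hsqT : 0 < Real.sqrt T := Real.sqrt_pos.2 hT
  have hr : 0 < r := lt_min one_pos (by positivity)
  have hr1 : r ≤ 1 := min_le_left _ _
  have hrT : r ^ 2 < T := by
    have h1 : r ≤ Real.sqrt T / 2 := min_le_right _ _
    have h2 : r ^ 2 ≤ (Real.sqrt T / 2) ^ 2 := pow_le_pow_left₀ hr.le h1 2
    have h3 : (Real.sqrt T / 2) ^ 2 = T / 4 := by rw [div_pow, Real.sq_sqrt hT.le]; norm_num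
    linarith
  refine ⟨r, hr, M, fun t ht x hx => ?_⟩
  have ht0 : 0 ≤ t := by linarith [ht.1]
  have htI : t ∈ Ico 0 T := ⟨ht0, ht.2⟩
  have hzK : ((t, x) : ℝ × EuclideanSpace ℝ (Fin 3)) ∈ K :=
    ⟨⟨ht0, ht.2.le.trans hTT''.le⟩, mem_closedBall.2 ((mem_ball.1 hx).le.trans hr1)⟩
  have h1 : u t x = W t x := by rw [hWU t htI]
  rw [h1]
  exact hM (t, x) hzK

/-- **Stub `stub_localClayTheory` of the crux `BoundedPlanarEnergyRegularity` (lines `birth`,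
`radon_topside`), per-datum local Clay theory.** For `ν > 0` and a smooth, divergence-free,
rapidly decaying datum `u₀`: if every classical solution of unforced NS on `ℝ³ × [0, T)` that is
Leray–Hopf on `[0, T]` from `u 0 = u₀` extends smoothly past `T` (all `T > 0`), then there is a
global smooth solution from `u₀` with bounded energy (Fefferman's (A) for that datum). Reduction
to `BoundedEnvelope.stub_clayOfBackwardBounded` through
`isBackwardBoundedAt_of_hasSmoothExtensionPast`. [cite: LemarieRieusset2016, Thm. 15.1 (C) and
Prop. 12.3] -/
theorem stub_localClayTheory :
    ∀ (ν : ℝ), 0 < ν → ∀ (u₀ : EuclideanSpace ℝ (Fin 3) → EuclideanSpace ℝ (Fin 3)),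
      ContDiff ℝ (⊤ : ℕ∞) u₀ → Literature.Analysis.FluidPDE.NSWave0.IsDivFree u₀ →
      Literature.Analysis.FluidPDE.HasRapidSpatialDecay u₀ →
      (∀ (T : ℝ), 0 < T →
        ∀ (u : ℝ → EuclideanSpace ℝ (Fin 3) → EuclideanSpace ℝ (Fin 3))
          (p : ℝ → EuclideanSpace ℝ (Fin 3) → ℝ),
          Literature.Analysis.FluidPDE.IsClassicalNSSolutionOn (Set.Ico 0 T) ν 0 u p →
          Literature.Analysis.FluidPDE.IsLerayHopfOn T ν 0 (u 0) u → u 0 = u₀ →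
          Literature.Analysis.FluidPDE.HasSmoothExtensionPast ν 0 u T) →
      ∃ (u : ℝ → EuclideanSpace ℝ (Fin 3) → EuclideanSpace ℝ (Fin 3))
        (p : ℝ → EuclideanSpace ℝ (Fin 3) → ℝ),
        Literature.Analysis.FluidPDE.IsSmoothOnHalfSpace u ∧
        Literature.Analysis.FluidPDE.IsSmoothOnHalfSpace p ∧
        Literature.Analysis.FluidPDE.IsNavierStokesSolution ν 0 u₀ u p ∧
        Literature.Analysis.FluidPDE.HasBoundedEnergy u := by
  intro ν hν u₀ hsm hdiv hdec hloc
  refine BoundedEnvelope.stub_clayOfBackwardBounded ν hν u₀ hsm hdec hdiv ?_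
  intro T hT u p hcl hLH h0 x₀
  have hLH' : IsLerayHopfOn T ν 0 (u 0) u := by rw [h0]; exact hLH
  exact isBackwardBoundedAt_of_hasSmoothExtensionPast hT (hloc T hT u p hcl hLH' h0) x₀

end Summit.NavierStokesRegularity.NavierStokesRegularity.Theorems.PlaneEnergyCeilingBoundedPlanarEnergyRegularity

end
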